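import Literature.Algebra.EuclideanLattices.LLLRunBounds
import HarnessLib

/-!
# Short vectors of a rank-`3` lattice through a rounded LLL basis: the coordinate box

Topic `Algebra/EuclideanLattices`. The fully PROVED bookkeeping behind "approximate a real lattice
basis `B` to `N` binary places, LLL-reduce the integer matrix `B̃ ≈ 2ᴺ B` exactly, and enumerate the
short vectors of the REAL lattice by their coordinates in the reduced basis" (Buchmann 1987 §3;
Cohen GTM 138 §2.7.3, Algorithm 2.7.5), in rank `3` with explicit constants. Given

* a real basis matrix `B` (rows) with co-norm `μ > 0` (`μ ‖v‖ ≤ ‖v B‖`, sup norms) all of whose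
  nonzero integer combinations have sup norm `≥ 1/2`, and an integer row `cγ` with `‖cγ B‖ ≤ 2`;
* an integer matrix `B̃` with `|Bᵢⱼ − B̃ᵢⱼ / P| ≤ δ`, `24 δ ≤ μ`;
* an integer matrix `L` generating the same lattice as `B̃` (`L = U B̃`, `B̃ = V L`) whose rows are
  LLL-reduced with `δ = 3/4`;

then (`shortVectorBox_fin_three`) `det B̃ ≠ 0`, `V U = 1`, and the coordinates `c' = cγ V` of `cγ`
in the basis `L` satisfy `c' U = cγ` and **`|c'ᵢ| ≤ 40`**. The two rank-`3` inputs — the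
enumeration box `|cᵢ| ≤ 4ρ/m + 2` for an LLL-reduced basis whose lattice has minimum `≥ m` and the
sup-norm perturbation bounds `‖c B̃/P‖ ∈ [‖c B‖ (1 − 3δ/μ), ‖c B‖ (1 + 3δ/μ)]` — are taken as
HYPOTHESES (`hC1`, `hC2`; they are the rank-`3` specialisations of `abs_coeff_le_of_isSizeReduced`,
`sq_le_two_pow_mul_sq_norm_gramSchmidt` and `norm_vecMul_perturb_le/ge` of
`LLLEnumerationBox.lean`). Constants: `m = 7P/16`, `ρ = (9√3/4) P`, `4ρ/m + 2 = 144√3/7 + 2 < 40`.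

## References

* J. Buchmann, *On the computation of units and class numbers by a generalization of Lagrange's
  algorithm*, J. Number Theory 26 (1987), §3. [folklore]
* H. Cohen, *A Course in Computational Algebraic Number Theory*, GTM 138 (1993), §2.7.3,
  Algorithm 2.7.5. [Cohen1993]
* A. K. Lenstra, H. W. Lenstra, L. Lovász, Math. Ann. 261 (1982), Prop. 1.6. [LenstraLenstraLovasz1982]
-/

noncomputable section

namespace Literature.Algebra.EuclideanLattices

open Matrix Finset

/-! ### Casting integer rows and matrices to `ℝ` -/

/-- The real row of an integer row. [folklore] -/
theorem cast_vecMul (c : Fin 3 → ℤ) (M : Matrix (Fin 3) (Fin 3) ℤ) :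
    (fun i => (((c ᵥ* M) i : ℤ) : ℝ)) = (fun i => (c i : ℝ)) ᵥ* M.map (Int.cast : ℤ → ℝ) := by
  funext j
  have h := RingHom.map_vecMul (Int.castRingHom ℝ) M c j
  simpa [Function.comp_def] using h

/-- `(c B̃) / P = c (B̃ / P)` for the rounded matrix read back in `ℝ`. [folklore] -/
theorem cast_vecMul_div (c : Fin 3 → ℤ) (Bt : Matrix (Fin 3) (Fin 3) ℤ) (P : ℝ) :
    (fun i => (c i : ℝ)) ᵥ* (Matrix.of fun i j => (Bt i j : ℝ) / P) =
      P⁻¹ • fun i => (((c ᵥ* Bt) i : ℤ) : ℝ) := by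
  rw [cast_vecMul]
  have hB : (Matrix.of fun i j => (Bt i j : ℝ) / P) = P⁻¹ • Bt.map (Int.cast : ℤ → ℝ) := by
    ext i j; simp [div_eq_inv_mul]
  rw [hB, Matrix.vecMul_smul]

/-- The sup norm of a real row dominates each entry. [folklore] -/
theorem abs_apply_le_norm (v : Fin 3 → ℝ) (i : Fin 3) : |v i| ≤ ‖v‖ := by
  have := norm_le_pi_norm v i
  rwa [Real.norm_eq_abs] at this

/-- **Euclidean versus sup norm, lower**: `|vₜ| ≤ ‖v‖₂` for an integer vector in `ℝ³`. [folklore] -/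
theorem abs_le_norm_intVecToEuclidean (v : Fin 3 → ℤ) (t : Fin 3) :
    |(v t : ℝ)| ≤ ‖intVecToEuclidean 3 v‖ :=
  abs_le.2 (abs_le_of_sq_le_sq' (sq_le_sq_norm_intVecToEuclidean v t) (norm_nonneg _))

/-- **Euclidean versus sup norm, upper**: `‖v‖₂ ≤ √3 · max |vₜ|` in `ℝ³`. [folklore] -/
theorem norm_intVecToEuclidean_le (v : Fin 3 → ℤ) {M : ℝ} (hM : 0 ≤ M) (h : ∀ t, |(v t : ℝ)| ≤ M) :
    ‖intVecToEuclidean 3 v‖ ≤ Real.sqrt 3 * M := by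
  have hsq : ‖intVecToEuclidean 3 v‖ ^ 2 ≤ (Real.sqrt 3 * M) ^ 2 := by
    rw [sq_norm_intVecToEuclidean, Fin.sum_univ_three, mul_pow, Real.sq_sqrt (by norm_num)]
    have h0 := sq_le_sq' (abs_le.1 (h 0)).1 (abs_le.1 (h 0)).2
    have h1 := sq_le_sq' (abs_le.1 (h 1)).1 (abs_le.1 (h 1)).2
    have h2 := sq_le_sq' (abs_le.1 (h 2)).1 (abs_le.1 (h 2)).2
    linarith
  exact (abs_le_of_sq_le_sq' hsq (by positivity)).2

/-- The sup norm of the real row of `c M` is at most the Euclidean norm of `∑ cᵢ • (row i of M)`.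
[folklore] -/
theorem norm_cast_vecMul_le_norm_sum (c : Fin 3 → ℤ) (L : Matrix (Fin 3) (Fin 3) ℤ) :
    ‖(fun i => (((c ᵥ* L) i : ℤ) : ℝ))‖ ≤ ‖∑ i, (c i : ℝ) • (⟨3, L⟩ : LatticeInstance).vec i‖ := by
  have h : ∑ i, (c i : ℝ) • (⟨3, L⟩ : LatticeInstance).vec i = intVecToEuclidean 3 (c ᵥ* L) := by
    have := (⟨3, L⟩ : LatticeInstance).ofCoeffs_eq_sum c
    simp only [LatticeInstance.ofCoeffs] at this
    rw [this]
    exact Finset.sum_congr rfl fun i _ => Int.cast_smul_eq_zsmul ℝ (c i) _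
  rw [h, pi_norm_le_iff_of_nonneg (norm_nonneg _)]
  intro t
  rw [Real.norm_eq_abs]
  exact abs_le_norm_intVecToEuclidean _ t

/-! ### Integer matrices: cancellation and unimodularity -/

/-- Right cancellation of an integer matrix of nonzero determinant: `M B̃ = N B̃ → M = N`. [folklore] -/
theorem mul_right_cancel_of_det_ne_zero {n : ℕ} {Bt M N : Matrix (Fin n) (Fin n) ℤ}
    (hdet : Bt.det ≠ 0) (h : M * Bt = N * Bt) : M = N := by
  have h1 : M * Bt * Bt.adjugate = N * Bt * Bt.adjugate := by rw [h]
  rw [Matrix.mul_assoc, Matrix.mul_assoc, Matrix.mul_adjugate, Matrix.mul_smul, Matrix.mul_smul,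
    Matrix.mul_one, Matrix.mul_one] at h1
  ext i j
  have := congr_fun (congr_fun h1 i) j
  simp only [Matrix.smul_apply, smul_eq_mul] at this
  exact mul_left_cancel₀ hdet this

/-- If `L = U B̃` and `B̃ = V L` with `det B̃ ≠ 0` then `V U = 1` and `U V = 1`. [folklore] -/
theorem unimodular_of_mutual {Bt L U V : Matrix (Fin 3) (Fin 3) ℤ} (hdet : Bt.det ≠ 0)
    (hU : L = U * Bt) (hV : Bt = V * L) : V * U = 1 ∧ U * V = 1 := by
  have h1 : V * U * Bt = 1 * Bt := by rw [Matrix.one_mul, Matrix.mul_assoc, ← hU, ← hV]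
  have hVU : V * U = 1 := mul_right_cancel_of_det_ne_zero hdet h1
  exact ⟨hVU, mul_eq_one_comm.1 hVU⟩

/-! ### The box -/

/-- `144 √3 / 7 + 2 < 40` (`√3 < 7/4`). [folklore] -/
theorem box_constant_lt : 4 * (9 * Real.sqrt 3 / 4) / (7 / 16) + 2 < (40 : ℝ) := by
  have h3 : Real.sqrt 3 < 7 / 4 := by
    rw [Real.sqrt_lt' (by norm_num)]; norm_num
  nlinarith [Real.sqrt_nonneg 3]

/-- **The coordinate box for the short vectors of a rank-`3` lattice through a rounded LLL basis.**
See the module docstring. [cite: Cohen1993, §2.7.3] -/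
theorem shortVectorBox_fin_three
    (hC1 : ∀ (b : Fin 3 → EuclideanSpace ℝ (Fin 3)), LinearIndependent ℝ b → IsLLLReduced (3 / 4) b →
      ∀ (m ρ : ℝ), 0 < m → (∀ c : Fin 3 → ℤ, c ≠ 0 → m ≤ ‖∑ i, (c i : ℝ) • b i‖) →
        ∀ c : Fin 3 → ℤ, ‖∑ i, (c i : ℝ) • b i‖ ≤ ρ → ∀ i, |(c i : ℝ)| ≤ 4 * ρ / m + 2)
    (hC2 : ∀ (B B' : Matrix (Fin 3) (Fin 3) ℝ) (δ μ : ℝ), 0 ≤ δ → 0 < μ →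
      (∀ i j, |B i j - B' i j| ≤ δ) → (∀ v : Fin 3 → ℝ, μ * ‖v‖ ≤ ‖Matrix.vecMul v B‖) → 3 * δ < μ →
      ∀ c : Fin 3 → ℤ,
        ‖Matrix.vecMul (fun i => (c i : ℝ)) B'‖ ≤ ‖Matrix.vecMul (fun i => (c i : ℝ)) B‖ * (1 + 3 * δ / μ) ∧
        ‖Matrix.vecMul (fun i => (c i : ℝ)) B‖ * (1 - 3 * δ / μ) ≤ ‖Matrix.vecMul (fun i => (c i : ℝ)) B'‖)
    (B : Matrix (Fin 3) (Fin 3) ℝ) (Bt L U V : Matrix (Fin 3) (Fin 3) ℤ) {P δ μ : ℝ} (hP : 0 < P)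
    (hδ : 0 ≤ δ) (hμ : 0 < μ) (h24 : 24 * δ ≤ μ)
    (happrox : ∀ i j, |B i j - (Bt i j : ℝ) / P| ≤ δ)
    (hco : ∀ v : Fin 3 → ℝ, μ * ‖v‖ ≤ ‖v ᵥ* B‖)
    (hshort : ∀ c : Fin 3 → ℤ, c ≠ 0 → 1 / 2 ≤ ‖(fun i => (c i : ℝ)) ᵥ* B‖)
    (cγ : Fin 3 → ℤ) (hγ : ‖(fun i => (cγ i : ℝ)) ᵥ* B‖ ≤ 2)
    (hU : L = U * Bt) (hV : Bt = V * L)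
    (hred : IsLLLReduced (3 / 4) (⟨3, L⟩ : LatticeInstance).vec) :
    Bt.det ≠ 0 ∧ V * U = 1 ∧ (cγ ᵥ* V) ᵥ* U = cγ ∧ ∀ i, |(((cγ ᵥ* V) i : ℤ) : ℝ)| ≤ 40 := by
  -- the rounded matrix read back in `ℝ`
  set B' : Matrix (Fin 3) (Fin 3) ℝ := Matrix.of fun i j => (Bt i j : ℝ) / P with hB'
  have happrox' : ∀ i j, |B i j - B' i j| ≤ δ := fun i j => by simpa [hB'] using happrox i j
  have h3δ : 3 * δ < μ := by linarith
  have hup : 1 + 3 * δ / μ ≤ 9 / 8 := by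
    rw [show (9 : ℝ) / 8 = 1 + 1 / 8 by norm_num]
    refine add_le_add le_rfl ?_
    rw [div_le_div_iff₀ hμ (by norm_num : (0 : ℝ) < 8)]; linarith
  have hlo : 7 / 8 ≤ 1 - 3 * δ / μ := by
    rw [show (7 : ℝ) / 8 = 1 - 1 / 8 by norm_num]
    refine sub_le_sub le_rfl ?_
    rw [div_le_div_iff₀ hμ (by norm_num : (0 : ℝ) < 8)]; linarith
  -- sup norms of integer combinations of `B̃`: `P ‖c B'‖`
  have hnorm : ∀ c : Fin 3 → ℤ, ‖(fun i => (((c ᵥ* Bt) i : ℤ) : ℝ))‖ = P * ‖(fun i => (c i : ℝ)) ᵥ* B'‖ := by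
    intro c
    rw [hB', cast_vecMul_div, norm_smul, Real.norm_eq_abs, abs_inv, abs_of_pos hP, ← mul_assoc,
      mul_inv_cancel₀ hP.ne', one_mul]
  have hlow : ∀ c : Fin 3 → ℤ, c ≠ 0 → 7 / 16 * P ≤ ‖(fun i => (((c ᵥ* Bt) i : ℤ) : ℝ))‖ := by
    intro c hc
    rw [hnorm c]
    have h := (hC2 B B' δ μ hδ hμ happrox' hco h3δ c).2
    have hs := hshort c hc
    have : 7 / 16 ≤ ‖(fun i => (c i : ℝ)) ᵥ* B‖ * (1 - 3 * δ / μ) := by nlinarith [norm_nonneg ((fun i => (c i : ℝ)) ᵥ* B)]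
    nlinarith
  have hupγ : ‖(fun i => (((cγ ᵥ* Bt) i : ℤ) : ℝ))‖ ≤ 9 / 4 * P := by
    rw [hnorm cγ]
    have h := (hC2 B B' δ μ hδ hμ happrox' hco h3δ cγ).1
    have : ‖(fun i => (cγ i : ℝ)) ᵥ* B‖ * (1 + 3 * δ / μ) ≤ 2 * (9 / 8) :=
      mul_le_mul hγ hup (by positivity) (by norm_num)
    nlinarith
  -- nonsingularity of `B̃`
  have hdet : Bt.det ≠ 0 := by
    intro h0
    obtain ⟨c, hc0, hc⟩ := Matrix.exists_vecMul_eq_zero_iff.2 h0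
    have h := hlow c hc0
    rw [hc] at h
    simp only [Pi.zero_apply, Int.cast_zero] at h
    have : ‖(fun _ : Fin 3 => (0 : ℝ))‖ = 0 := by simp
    rw [this] at h
    linarith
  obtain ⟨hVU, hUV⟩ := unimodular_of_mutual hdet hU hV
  have hcoord : (cγ ᵥ* V) ᵥ* U = cγ := by rw [Matrix.vecMul_vecMul, hVU, Matrix.vecMul_one]
  refine ⟨hdet, hVU, hcoord, ?_⟩
  -- the reduced basis as vectors of `ℝ³`
  have hdetL : L.det ≠ 0 := by
    rw [hU, Matrix.det_mul]
    refine mul_ne_zero ?_ hdet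
    have := congrArg Matrix.det hUV
    rw [Matrix.det_mul, Matrix.det_one] at this
    exact left_ne_zero_of_mul_eq_one this
  have hli : LinearIndependent ℝ (⟨3, L⟩ : LatticeInstance).vec :=
    LatticeInstance.linearIndependent_vec (I := ⟨3, L⟩) hdetL
  -- minimum and the short combination, in the basis `L`
  have hmin : ∀ c : Fin 3 → ℤ, c ≠ 0 → 7 / 16 * P ≤ ‖∑ i, (c i : ℝ) • (⟨3, L⟩ : LatticeInstance).vec i‖ := by
    intro c hc
    refine le_trans ?_ (norm_cast_vecMul_le_norm_sum c L)
    have hcU : c ᵥ* U ≠ 0 := by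
      intro h0
      apply hc
      have := congrArg (fun w => w ᵥ* V) h0
      simp only [Matrix.vecMul_vecMul, hUV, Matrix.vecMul_one, Matrix.zero_vecMul] at this
      exact this
    have := hlow (c ᵥ* U) hcU
    rwa [Matrix.vecMul_vecMul, ← hU] at this
  have hργ : ‖∑ i, (((cγ ᵥ* V) i : ℤ) : ℝ) • (⟨3, L⟩ : LatticeInstance).vec i‖ ≤ 9 * Real.sqrt 3 / 4 * P := by
    have h : ∑ i, (((cγ ᵥ* V) i : ℤ) : ℝ) • (⟨3, L⟩ : LatticeInstance).vec i =
        intVecToEuclidean 3 ((cγ ᵥ* V) ᵥ* L) := by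
      have := (⟨3, L⟩ : LatticeInstance).ofCoeffs_eq_sum (cγ ᵥ* V)
      simp only [LatticeInstance.ofCoeffs] at this
      rw [this]
      exact Finset.sum_congr rfl fun i _ => Int.cast_smul_eq_zsmul ℝ ((cγ ᵥ* V) i) _
    rw [h, show (cγ ᵥ* V) ᵥ* L = cγ ᵥ* Bt by rw [hV, ← Matrix.vecMul_vecMul]]
    calc ‖intVecToEuclidean 3 (cγ ᵥ* Bt)‖ ≤ Real.sqrt 3 * (9 / 4 * P) :=
          norm_intVecToEuclidean_le _ (by positivity) fun t =>
            (abs_apply_le_norm (fun i => (((cγ ᵥ* Bt) i : ℤ) : ℝ)) t).trans hupγ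
      _ = 9 * Real.sqrt 3 / 4 * P := by ring
  -- the enumeration box
  intro i
  have h := hC1 _ hli hred (7 / 16 * P) (9 * Real.sqrt 3 / 4 * P) (by positivity) hmin _ hργ i
  have heq : 4 * (9 * Real.sqrt 3 / 4 * P) / (7 / 16 * P) + 2 = 4 * (9 * Real.sqrt 3 / 4) / (7 / 16) + 2 := by
    field_simp
  rw [heq] at h
  exact h.trans box_constant_lt.le

end Literature.Algebra.EuclideanLattices

end
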